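import Literature.Topology.FourManifolds.BasinSetting
import HarnessLib

/-!
# The basin setting: the basin of the minimum and the trajectories of the slab flow

Topic `Literature/Topology/FourManifolds`; third file of the endgame of the Torelli half of
Griffiths' handlebody theorem (`BasinSetting.lean`: the data).  Everything here is **proved**.

For `B : BasinSetting g ξ`: the **basin** `B.basin = unstableSet ξ p₀` (open; every point lies
in it or on the ascending set of another critical point, `OneHandlebodyBasin.lean`), the
**traces** `B.traces ⊆ ∂W` of the other ascending sets (closed), and the dynamics of the slab
flow `B.θ` (`SlabDynamics.lean`) specialised to the slab `[g p₀/2, hi]` which contains ALL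
critical points: `g` is monotone along the flow, every backward flow line from `{g ≤ hi}`
converges to a critical point (`exists_tendsto_atBot`: falling below the slab is impossible),
basin membership is read on backward limits and is flow-invariant (`mem_basin_iff_tendsto`,
`θ_mem_basin_iff`), basin trajectories cross every level between `g p₀` and their start
(`exists_apply_θ_eq_of_mem_basin`), points of `[L, hi]` come from `L` and rise to `hi`
(`exists_apply_θ_eq_L`, `exists_apply_θ_eq_of_L_le`: no critical value there), the levels `L`
and `sph` are transversal, the hitting time of `L` is unique and the points hitting `L` form an
open set (`FlowHittingTime.lean`).

## References

* J. Milnor, *Lectures on the h-cobordism theorem*, notes by L. Siebenmann and J. Sondow,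
  Princeton Mathematical Notes (1965): Def. 3.1, proof of Thm. 3.4 (PDF pp. 11–13), Def. 3.9
  (PDF p. 16), Thm. 4.1 (PDF p. 22), proof of Thm. 5.4, Assertion 4 (PDF p. 29).
  [MilnorHCobordism1965]
* J. Milnor, *Morse theory* (1963), Thm. 3.1 and proof of Thm. 4.1 (p. 25). [Milnor1963]
* H. B. Griffiths, *Automorphisms of a 3-dimensional handlebody*, Abh. Math. Sem. Univ. Hamburg
  26 (1964), §§3–6. [GriffithsHB1964Handlebody]
-/

open scoped Manifold ContDiff Topology
open Set Function Filter Metric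

noncomputable section

namespace Literature.Topology.FourManifolds

open Cobordism FourManifolds.Flow

universe u

variable {n : ℕ} {W : Type u} [TopologicalSpace W] [T2Space W] [SecondCountableTopology W]
  [CompactSpace W] [ChartedSpace (EuclideanHalfSpace (n + 1)) W] [IsManifold (𝓡∂ (n + 1)) ∞ W]

/-! ### The basin of `p₀` and the trajectories of the slab flow -/

namespace BasinSetting

variable {g : W → ℝ} {ξ : Π x : W, TangentSpace (𝓡∂ (n + 1)) x} (B : BasinSetting g ξ)

/-- `ξ` as a smooth section of the tangent bundle. [folklore] -/
def ξsec : Cₛ^∞⟮𝓡∂ (n + 1); EuclideanSpace ℝ (Fin (n + 1)),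
    (TangentSpace (𝓡∂ (n + 1)) : (Cobordism.ofBoundary n W).W → Type)⟯ :=
  ⟨ξ, B.contMDiff⟩

/-- The section `ξsec` is `ξ`. [folklore] -/
@[simp] theorem coe_ξsec : ⇑B.ξsec = ξ := rfl

/-- **The basin** of the `0`-handle: the unstable set of `p₀` (the points on trajectories coming
from the minimum). [cite: MilnorHCobordism1965, Def. 3.9 (PDF p. 16)] -/
def basin : Set W := unstableSet (𝓡∂ (n + 1)) ξ B.p₀

/-- Unfolding `basin`. [folklore] -/
theorem mem_basin_iff (x : W) : x ∈ B.basin ↔ x ∈ unstableSet (𝓡∂ (n + 1)) ξ B.p₀ := Iff.rfl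

/-- **The basin is open.** [cite: MilnorHCobordism1965, Def. 3.1 (2), Def. 3.9] -/
theorem isOpen_basin : IsOpen B.basin := by
  have h := B.isMorseFunction.isOpen_unstableSet_ofBoundary B.ξsec B.isGradientLike
    B.p₀_mem_criticalSetOfIndex
  exact h

/-- `p₀` lies in its basin (the constant trajectory). [folklore] -/
theorem p₀_mem_basin : B.p₀ ∈ B.basin :=
  ⟨fun _ => B.p₀, rfl, (isMIntegralCurve_const
    (B.isGradientLike.apply_eq_zero_of_isMCriticalPt B.isMCriticalPt_p₀)).isMIntegralCurveOn _,
    tendsto_const_nhds⟩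

/-- **Every point lies in the basin or on the ascending set of another critical point.**
[cite: MilnorHCobordism1965, proof of Thm. 4.1 (PDF p. 22)] -/
theorem mem_basin_or_exists (x : W) :
    x ∈ B.basin ∨ ∃ q, IsMCriticalPt (𝓡∂ (n + 1)) g q ∧ q ≠ B.p₀ ∧
      x ∈ unstableSet (𝓡∂ (n + 1)) ξ q := by
  obtain ⟨q, hq, hx⟩ := B.isMorseFunction.exists_mem_unstableSet_ofBoundary B.ξsec B.isGradientLike x
  rw [coe_ξsec] at hx
  by_cases hqp : q = B.p₀
  · left; rw [hqp] at hx; exact hx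
  · right; exact ⟨q, hq, hqp, hx⟩

/-- **The traces**: the boundary points NOT in the basin, i.e. on the ascending sets of the
critical points other than `p₀` (for a `1`-handlebody of dimension `3`: the co-core circles).
[cite: MilnorHCobordism1965, Def. 3.9 (PDF p. 16)] -/
def traces : Set ((𝓡∂ (n + 1)).boundary W) := {y | (y : W) ∉ B.basin}

/-- Unfolding `traces`. [folklore] -/
theorem mem_traces_iff (y : (𝓡∂ (n + 1)).boundary W) : y ∈ B.traces ↔ (y : W) ∉ B.basin := Iff.rfl

/-- The traces form a closed subset of `∂W`. [folklore] -/
theorem isClosed_traces : IsClosed B.traces := by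
  have : IsOpen {y : (𝓡∂ (n + 1)).boundary W | (y : W) ∈ B.basin} :=
    B.isOpen_basin.preimage continuous_subtype_val
  rw [← isOpen_compl_iff]
  convert this using 1
  ext y; simp [traces]

/-! #### The flow -/

/-- The flow is continuous. [folklore] -/
theorem continuous_θ : Continuous B.θ := B.isSmoothFlow.continuous

/-- `θ(0, x) = x`. [folklore] -/
theorem θ_zero (x : W) : B.θ (0, x) = x := B.isSmoothFlow.map_zero x

/-- The group law. [folklore] -/
theorem θ_add (t s : ℝ) (x : W) : B.θ (t, B.θ (s, x)) = B.θ (t + s, x) := B.isSmoothFlow.map_add t s x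

/-- `t ↦ g (θ (t, x))` is continuous. [folklore] -/
theorem continuous_apply_θ (x : W) : Continuous fun t => g (B.θ (t, x)) :=
  B.isMorseFunction.isMorse.contMDiff.continuous.comp (B.continuous_θ.comp (Continuous.prodMk_left x))

/-- **`g` does not decrease along the flow.** [cite: MilnorHCobordism1965, Def. 3.1 (1)] -/
theorem monotone_apply_θ (x : W) : Monotone fun t => g (B.θ (t, x)) := B.preSlabFlow.monotone x

/-- `g (θ (t, x)) ≤ g x` for `t ≤ 0`. [folklore] -/
theorem apply_θ_le {x : W} {t : ℝ} (ht : t ≤ 0) : g (B.θ (t, x)) ≤ g x := by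
  have := B.monotone_apply_θ x ht; simpa only [θ_zero] using this

/-- `g x ≤ g (θ (t, x))` for `0 ≤ t`. [folklore] -/
theorem le_apply_θ {x : W} {t : ℝ} (ht : 0 ≤ t) : g x ≤ g (B.θ (t, x)) := by
  have := B.monotone_apply_θ x ht; simpa only [θ_zero] using this

/-- Critical points are fixed by the flow. [folklore] -/
theorem θ_eq_self_of_isMCriticalPt {p : W} (hp : IsMCriticalPt (𝓡∂ (n + 1)) g p) (t : ℝ) :
    B.θ (t, p) = p := B.slabFlow'.apply_eq_self_of_isMCriticalPt hp t

/-! #### Backward limits -/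

/-- **Every backward flow line from `{g ≤ hi}` converges to a critical point from which the
starting point comes** (the alternative of the backward dichotomy — falling below the bottom
`lo` of the slab — is excluded, `g > lo` everywhere). [cite: MilnorHCobordism1965, proof of Thm. 4.1 (PDF p. 22)] -/
theorem exists_tendsto_atBot {x : W} (hx : g x ≤ B.hi) :
    ∃ p, IsMCriticalPt (𝓡∂ (n + 1)) g p ∧ g p ≤ g x ∧
      Tendsto (fun t => B.θ (t, x)) atBot (𝓝 p) ∧ x ∈ unstableSet (𝓡∂ (n + 1)) ξ p := by
  rcases B.preSlabFlow.exists_lt_or_exists_tendsto_atBot hx with ⟨t, -, ht⟩ | ⟨p, hp, hfp, hconv, hxp⟩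
  · exact absurd (B.lo_lt_apply _) (not_lt.2 ht.le)
  · exact ⟨p, hp, hfp.2, hconv, hxp⟩

/-- **Basin membership through backward limits**: a point of `{g ≤ hi}` lies in the basin iff
its backward flow line converges to `p₀`. [cite: MilnorHCobordism1965, Def. 3.9 (PDF p. 16)] -/
theorem mem_basin_iff_tendsto {x : W} (hx : g x ≤ B.hi) :
    x ∈ B.basin ↔ Tendsto (fun t => B.θ (t, x)) atBot (𝓝 B.p₀) :=
  B.preSlabFlow.mem_unstableSet_iff_tendsto hx B.lo_lt_apply_p₀.le

/-- Shifting the starting point along its flow line does not change backward limits. [folklore] -/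
theorem tendsto_θ_atBot_iff (s : ℝ) {x p : W} :
    Tendsto (fun t => B.θ (t, B.θ (s, x))) atBot (𝓝 p) ↔ Tendsto (fun t => B.θ (t, x)) atBot (𝓝 p) := by
  simp_rw [B.θ_add]
  constructor
  · intro h
    have h' := h.comp (tendsto_atBot_add_const_right atBot (-s) tendsto_id)
    refine h'.congr fun t => ?_
    simp
  · intro h
    exact h.comp (tendsto_atBot_add_const_right atBot s tendsto_id)

/-- **The basin is invariant under the flow** (inside `{g ≤ hi}`). [cite: MilnorHCobordism1965, Def. 3.9 (PDF p. 16)] -/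
theorem θ_mem_basin_iff {x : W} {t : ℝ} (hx : g x ≤ B.hi) (ht : g (B.θ (t, x)) ≤ B.hi) :
    B.θ (t, x) ∈ B.basin ↔ x ∈ B.basin := by
  rw [B.mem_basin_iff_tendsto ht, B.mem_basin_iff_tendsto hx, B.tendsto_θ_atBot_iff]

/-- A point of the basin other than `p₀` is not critical (its backward flow line converges to
`p₀`, while a critical point is fixed). [folklore] -/
theorem not_isMCriticalPt_of_mem_basin {x : W} (hx : x ∈ B.basin) (hxp : x ≠ B.p₀)
    (hxhi : g x ≤ B.hi) : ¬ IsMCriticalPt (𝓡∂ (n + 1)) g x := fun hc => by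
  have h1 := (B.mem_basin_iff_tendsto hxhi).1 hx
  have h2 : Tendsto (fun t => B.θ (t, x)) atBot (𝓝 x) := by
    simp_rw [B.θ_eq_self_of_isMCriticalPt hc]; exact tendsto_const_nhds
  exact hxp (tendsto_nhds_unique h2 h1)

/-! #### Crossing levels -/

/-- **A basin trajectory crosses, backwards, every level between `g p₀` and its starting value**
(it converges to `p₀`; intermediate value theorem). [cite: MilnorHCobordism1965, §4 (PDF p. 21)] -/
theorem exists_apply_θ_eq_of_mem_basin {x : W} (hx : x ∈ B.basin) (hxhi : g x ≤ B.hi) {ℓ : ℝ}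
    (hℓ : ℓ ∈ Ioc (g B.p₀) (g x)) : ∃ t, t ≤ 0 ∧ g (B.θ (t, x)) = ℓ := by
  have hconv := (B.mem_basin_iff_tendsto hxhi).1 hx
  have hlim : Tendsto (fun t => g (B.θ (t, x))) atBot (𝓝 (g B.p₀)) :=
    (B.isMorseFunction.isMorse.contMDiff.continuous.tendsto _).comp hconv
  obtain ⟨t₁, ht₁, ht₁'⟩ := ((hlim.eventually (Iio_mem_nhds hℓ.1)).and (eventually_le_atBot 0)).exists
  have hmem : ℓ ∈ Icc (g (B.θ (t₁, x))) (g (B.θ (0, x))) := ⟨ht₁.le, by rw [θ_zero]; exact hℓ.2⟩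
  obtain ⟨t, ht, hft⟩ := intermediate_value_Icc ht₁' (B.continuous_apply_θ x).continuousOn hmem
  exact ⟨t, ht.2, hft⟩

/-- **A point at or above the level `L` is reached from the level `L`**: its backward flow line
converges to a critical point, all of which lie below `L`. [cite: MilnorHCobordism1965, Thm. 4.1 (PDF p. 22)] -/
theorem exists_apply_θ_eq_L {x : W} (hxL : B.L ≤ g x) (hxhi : g x ≤ B.hi) :
    ∃ t, t ≤ 0 ∧ g (B.θ (t, x)) = B.L :=
  B.preSlabFlow.exists_apply_eq_of_forall_not_mem_Icc' hxhi hxL B.L_mem_Ioo.1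
    fun _ hp hmem => absurd (B.apply_lt_L_of_isMCriticalPt hp) (not_lt.2 hmem.1)

/-- **A point at or above the level `L` rises to every level up to `hi`**: no critical value
lies in `[L, hi]`. [cite: MilnorHCobordism1965, Thm. 4.1 (PDF p. 22)] -/
theorem exists_apply_θ_eq_of_L_le {x : W} (hxL : B.L ≤ g x) {ℓ : ℝ} (hℓ : ℓ ∈ Icc (g x) B.hi)
    (hℓ' : ℓ < B.hi) : ∃ t, 0 ≤ t ∧ g (B.θ (t, x)) = ℓ :=
  B.preSlabFlow.exists_apply_eq_of_forall_not_mem_Icc (B.lo_lt_apply x).le hℓ.1 hℓ'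
    fun _ hp hmem => absurd ((B.apply_lt_L_of_isMCriticalPt hp).trans_le hxL) (not_lt.2 hmem.1)

/-- **Every trajectory of the basin through the level `L` meets every level in `(g p₀, hi)`.**
[cite: MilnorHCobordism1965, Thm. 4.1 (PDF p. 22)] -/
theorem hits_of_mem_basin_of_apply_eq_L {w : W} (hw : w ∈ B.basin) (hwL : g w = B.L) {ℓ : ℝ}
    (hℓ : ℓ ∈ Ioo (g B.p₀) B.hi) : Hits B.θ g ℓ w := by
  rcases le_or_gt ℓ (g w) with h | h
  · obtain ⟨t, -, ht⟩ := B.exists_apply_θ_eq_of_mem_basin hw (by rw [hwL]; exact B.L_lt_hi.le) ⟨hℓ.1, h⟩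
    exact ⟨t, ht⟩
  · obtain ⟨t, -, ht⟩ := B.exists_apply_θ_eq_of_L_le hwL.ge ⟨h.le, hℓ.2.le⟩ hℓ.2
    exact ⟨t, ht⟩

/-- A point of `{g ≤ L}` on the basin other than `p₀` hits the level `L`... more generally every
point `x` of the basin with `x ≠ p₀` and `g x ≤ hi` hits `L` when `L ≤ g x`, and when `g x ≤ L`
iff ... — here the case used: **a basin point below `hi` whose forward flow line is not caught
by a critical point hits `L`**; we record the two unconditional cases.  First: points of
`[L, hi]`. [cite: MilnorHCobordism1965, Thm. 4.1 (PDF p. 22)] -/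
theorem hits_L_of_L_le {x : W} (hxL : B.L ≤ g x) (hxhi : g x ≤ B.hi) : Hits B.θ g B.L x := by
  obtain ⟨t, -, ht⟩ := B.exists_apply_θ_eq_L hxL hxhi
  exact ⟨t, ht⟩

/-- The level `L` is transversal to the cut-off field (it carries no critical point). [cite: MilnorHCobordism1965, Def. 3.1 (1)] -/
theorem transversal_L : ∀ x : (Cobordism.ofBoundary n W).W, g x = B.L →
    0 < mlineDeriv (𝓡∂ (n + 1)) (M := (Cobordism.ofBoundary n W).W) g x
      (slabField (c := Cobordism.ofBoundary n W) g ξ B.lo B.hi x) :=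
  B.preSlabFlow.mlineDeriv_slabField_pos_of_apply_eq (Ioo_subset_Icc_self B.L_mem_Ioo)
    fun _ hx => B.not_isMCriticalPt_of_eq_L hx

/-- The level `sph` of the chart sphere is transversal to the cut-off field. [cite: MilnorHCobordism1965, Def. 3.1 (1)] -/
theorem transversal_sph : ∀ x : (Cobordism.ofBoundary n W).W, g x = B.sph →
    0 < mlineDeriv (𝓡∂ (n + 1)) (M := (Cobordism.ofBoundary n W).W) g x
      (slabField (c := Cobordism.ofBoundary n W) g ξ B.lo B.hi x) :=
  B.preSlabFlow.mlineDeriv_slabField_pos_of_apply_eq (Ioo_subset_Icc_self B.sph_mem_Ioo)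
    fun _ hx => B.not_isMCriticalPt_of_mem (by rw [hx]; exact ⟨B.apply_p₀_lt_sph, le_rfl⟩)

/-- **Uniqueness of the hitting time of `L`.** [cite: MilnorHCobordism1965, proof of Thm. 5.4, Assertion 4 (PDF p. 29)] -/
theorem hittingTime_L_eq {x : W} {t : ℝ} (ht : g (B.θ (t, x)) = B.L) : hittingTime B.θ g B.L x = t :=
  B.isSmoothFlow.hittingTime_unique B.preSlabFlow.mdifferentiable_f B.transversal_L ht

include B in
/-- Points of `{g < 1}` are interior points of `W`. [cite: MilnorHCobordism1965, Def. 3.1] -/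
theorem isInteriorPoint_of_lt {x : W} (hx : g x < 1) : (𝓡∂ (n + 1)).IsInteriorPoint x :=
  B.isMorseFunction.isInteriorPoint_of_apply_mem_Ioo ⟨B.apply_pos x, hx⟩

/-- **The points hitting `L` form an open subset of `{g < 1}`**: near a point of `{g < 1}`
hitting `L`, all points hit `L`. [cite: MilnorHCobordism1965, proof of Thm. 5.4, Assertion 4 (PDF p. 29)] -/
theorem hits_L_mem_nhds {x : W} (hx : g x < 1) (hhit : Hits B.θ g B.L x) :
    {z | Hits B.θ g B.L z} ∈ 𝓝 x :=
  B.isSmoothFlow.hits_mem_nhds B.isMorseFunction.isMorse.contMDiff B.transversal_L hhit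
    (B.isInteriorPoint_of_lt hx)

end BasinSetting

end Literature.Topology.FourManifolds
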